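import Literature.MathematicalPhysics.QuantumFieldTheory.Balaban1983to89.B12NodeKnitRecord13SepCoPH
import Literature.MathematicalPhysics.QuantumFieldTheory.Balaban1983to89.Node00.TransportOfRecordGaugeAE
import Summits.QuantumFields.YangMills.Theorems.BalabanUVNodesN09LiftInvariance29AtRecord

/-!
# BalabanUVNodes ∕ N09 at the STAGE-13 v1.7 `SepCoPH` record — the Theorem-3 member ON THE SMALL-FIELD DOMAINS: the cut-off invariance (M1) and the support clause asked
# only ALMOST EVERYWHERE OVER THE FIBRES OF REGULAR COARSE FIELDS `Ū ∈ domAltOfRecord`, the bookkeeping sets `regSetOfRecord K i ρ_i ∩ domAltOfRecord (i+1)` — the junk corner of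
# the record's `critCfgOfRecord` (coarse fields off the solvable ∕ small-field region) is OUTSIDE every hypothesis

TRACK A (YM-PLAN §2b, node N09 = [B12] = [Balaban1987RG1] Thm 3 p. 264), WIDTH SEAT `pub-ymgap-dag-n09-w3` (g0; HUMAN RULING D-0149; plan g77∕g78 W-SEAT-START-LIST §n09 item 3),
FILE 5 — the N09-side «engine variant with lift-invariance of ρ only on Ū⁻¹(S), S gauge-stable» dag-n24-c's HOURLY-4 names as trigger (t-eng).  Key of record it serves: K1⁷
`StabilityBAtRecordR13SepCoPH` = stmt-QuantumFields-20542 (`--supports`, count-neutral helper).  Imports dag-n24-c's junction and this seat's Literature module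
`Node00/TransportOfRecordGaugeAE` (`transportOfRecord_gaugeAct_ae_eq_on`, `TcanOfRecord_gaugeAct_of_mem_regSet_inter_of_on`).  THEOREMS ONLY, def-free, sorry-free.

WHY.  At the bare-choice record (M1) «χ^{(2.9)}_j lift-invariant» is FALSE in regime, pointwise (dag-n09-w2 `not_h09inv_of_junkWitness`) and — the witness being an open condition —
also in the global a.e. currency of this seat's FILE 2: the obstruction lives in the JUNK CORNER `{U : Ū unsolvable}`, where `critCfgOfRecord` is the constant `M^j(1)`.  Print never
visits that corner: χ_k and T_k are read over REGULAR `W` only ([I] (2.1) p. 265 L11–17).  THIS FILE re-runs dag-n09-a's on-domain engine (MODULE 5) and dag-n24-c's junction with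
EVERY χ-hypothesis relativised to the fibres over the record's small-field domain of the next level and read a.e.: per step `j`, with `S_{j+1} := domAltOfRecord θ.ν K (j+1)` (open,
gauge-stable — dag-n09-a `isOpen_domAltOfRecord` ∕ `domAltOfRecord_gaugeAct_mem`) and `D_{j+1} := regSetOfRecord K j ρ_j ∩ S_{j+1}`:
(M1-dom) «`χ_j(U^{v∘blockOf}) = χ_j(U)` for `dU`-a.e. `U` with `Ū ∈ S_{j+1}`» (what dag-n09-w2's (181)-COVARIANCE ON THE SOLVABLE SET delivers once the small-field domain of
level `j+1` lies in the solvable set at the cut-off's radius `ν.εreg` — [B11] Thm 1 at the record, N07's content); (F7a-dom) «for `dU`-a.e. `U` with `Ū ∈ S_{j+1}`: `χ_j(U) ≠ 0 ⇒ U ∈ D_j`» (support inside the previous regular set AND the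
small-field domain — [I] p. 256 l. 6, (2.1) p. 265, the threshold hierarchy (2.9)⇒(1.2) of K0e `mem_domAltOfRecord_of_chiFix29_eq_one`, and K0e's analytic debt (F1)–(F3) on
REGULAR fields only); then `ρ_j` is lift-invariant a.e. over `Ū⁻¹ S_{j+1}`, so (Module A) the transform is a.e. invariant ON `S_{j+1}` and the v1.7 token `TcanOfRecord` is gauge
invariant at every point of `D_{j+1}` — the per-step input of the engine — WITHOUT any statement about the junk corner.  The pointwise members that remain are print's: invariance
of `A_j` ON `D_j`, and the NESTING «`Ū^{i+1}(U_k V) ∈ regSetOfRecord K i ρ_i ∩ domAltOfRecord (i+1)`» of the averaged backgrounds of regular `V` ((F7b) ∧ [I] (1.2)∕(2.1) nesting).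

WHAT THIS FILE PROVES (11 theorems).  §1 engine on stable sets (any transport): `integrand_comp_liftAct_ae_eq_on_of_invOn`, `invOn_effActionHT_of_stepsOn_on`, `hCompT_of_stepsOn_on`,
`thm3Member_of_indATPlug_of_stepsOn_on`.  §2 the per-step supplier of the v1.7 token on `regSet ∩ O` for an open stable `O`: `domAltOfRecord_gaugeAct_mem_iff`,
`stepOn_TβOfRecord₁₃_of_subset_regSet_inter_of_on`.  §3 at the record: `thm3Member_stage13SepCoPH_onDomains`, `thm3Member_forall_stage13SepCoPH_onDomains` (N24's `h09T` from (M1-dom),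
(F7a-dom), (I19), [B11] ×3, nesting), `thm3Member_forall_stage13SepCoPH_onDomains_of_measurableUk` ((I19) ↦ (H-U)).  §4: `chiβ13_gaugeAct_liftTransf_ae_on_of_covariantOn` ((M1-dom) ⇐ dag-n09-w2's (181)-covariance
on the solvable set + [B11] Thm 1 existence on the small-field domain at radius `ν.εreg`), `thm3Member_forall_stage13SepCoPH_onDomains_of_covariantOn` (the `h09T` supplier with the
selection clause located at [B11] (181) — NO χ-invariance hypothesis left).

HONEST FRAMING: count-neutral kernel bookkeeping BY NAME; NO estimate of Bałaban's; (M1-dom), (F7a-dom), (I19)∕(H-U), [B11] Thm 1 ×3 and the nesting are DISPLAYED hypotheses, located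
in print, none asserted — (M1-dom)'s supplier is a selection-covariance theorem on the solvable set (dag-n09-w2's lane), (F7a-dom) keeps K0e's analytic debt on REGULAR fields; N09
NOT discharged; conjunct 1 untouched; K0⁷ ∕ K1⁷ NOT closed; counts unmoved (typed 28∕28 · discharged 5∕27); one finite four-torus programme at fixed ε — R4 closes the conditional
rung `BalabanLadder.UV` only; NOT ℝ⁴ ∕ infinite volume ∕ OS ∕ mass gap ∕ Clay.
-/

noncomputable section

namespace Summit.QuantumFields.YangMills.BalabanUVNodes.N09AtRecord13SepCoPHOnDomains

open MeasureTheory Set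
open Literature.MathematicalPhysics.QuantumFieldTheory.Balaban1983to89
open Literature.MathematicalPhysics.QuantumFieldTheory.Balaban1983to89.T4Continuum (T4Family)
open Literature.MathematicalPhysics.QuantumFieldTheory.Balaban1983to89.DagBinding (WorldP leavesP)
open Literature.MathematicalPhysics.QuantumFieldTheory.Balaban1983to89.Node00
open Literature.MathematicalPhysics.QuantumFieldTheory.Balaban1983to89.FlowStep (HBeta prefixOf)
open Literature.MathematicalPhysics.QuantumFieldTheory.Balaban1983to89.FlowStepRuns (genSeq genFlow)
open Literature.MathematicalPhysics.QuantumFieldTheory.Balaban1983to89.T4FlagMemory (extd)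
open Literature.MathematicalPhysics.QuantumFieldTheory.Balaban1983to89.B12Eq019ActionBody (integrand integrand_apply)
open Literature.MathematicalPhysics.QuantumFieldTheory.Balaban1983to89.B12RTGaugeInvariance254 (LiftInvariant liftTransf invTransf gaugeAct_inv_gaugeAct)
open Literature.MathematicalPhysics.QuantumFieldTheory.Balaban1983to89.GaugeField (GaugeInvariant gaugeAct)
open Literature.MathematicalPhysics.QuantumFieldTheory.Balaban1983to89.B12EffectiveActionInvarianceT (gfOfRecord_liftInvariant)
open Literature.MathematicalPhysics.QuantumFieldTheory.Balaban1983to89.B12ContinuousTransportInvarianceOn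
  (invOn_effActionHT_succ_of_stepOn hCompT_of_hOrbit_of_invOn isOpen_domAltOfRecord domAltOfRecord_gaugeAct_mem)
open Literature.MathematicalPhysics.QuantumFieldTheory.Balaban1983to89.B12NodeKnitIndAPlug (thm3Member_of_indATPlug_of_hCompT)
open Literature.MathematicalPhysics.QuantumFieldTheory.Balaban1983to89.B12NodeKnitRecord13SepCoPH
  (flow_stage13SepCoPH indAss_stage13SepCoPH_iff integrable_betaInput_stage13_of_measurableUk)

/-! ## §1. The on-domain engine with every χ-hypothesis relativised to the fibres over a coarse set `S (j+1)` and read a.e. (any transport family) -/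

section Engine

variable {F : T4Family} {N : ℕ} [NeZero N]

/-- **THE (0.19) DENSITY IS LIFT-INVARIANT A.E. OVER THE FIBRES OF `S′` FROM ON-SET INVARIANCE OF `A`**: if `χ(U^{ṽ}) = χ(U)` and «`U ∉ D ⇒ χ(U) = 0`» hold for `dU`-a.e. `U` WITH
`Ū ∈ S′`, `GF` is lift-invariant, and `A(U^{ṽ}) = A(U)` for every `U ∈ D`, then `ρ = χ·exp[−GF/g² + A]` satisfies `ρ(U^{ṽ}) = ρ(U)` for `dU`-a.e. `U` with `Ū ∈ S′`.
[cite: Balaban1987RG1, (0.19) p.255, p.263 and (2.1) p.265] -/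
theorem integrand_comp_liftAct_ae_eq_on_of_invOn {K j : ℕ} {χ GF A : Density (F.P K) j (SU N)} {S' : Set (GaugeField (F.P K) (j + 1) (SU N))}
    (hχ : ∀ v : GaugeTransf (F.P K) (j + 1) (SU N), ∀ᵐ U ∂(fieldMeasure (F.P K) j (SU N)),
      (avOfRecord F N K j).avg U ∈ S' → χ (gaugeAct (liftTransf v) U) = χ U)
    (hGF : LiftInvariant GF) {D : Set (GaugeField (F.P K) j (SU N))}
    (hχD : ∀ᵐ U ∂(fieldMeasure (F.P K) j (SU N)), (avOfRecord F N K j).avg U ∈ S' → U ∉ D → χ U = 0)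
    (hA : ∀ (v : GaugeTransf (F.P K) (j + 1) (SU N)) (U : GaugeField (F.P K) j (SU N)), U ∈ D → A (gaugeAct (liftTransf v) U) = A U) (gk : ℝ)
    (v : GaugeTransf (F.P K) (j + 1) (SU N)) :
    ∀ᵐ U ∂(fieldMeasure (F.P K) j (SU N)), (avOfRecord F N K j).avg U ∈ S' →
      integrand χ GF gk A (gaugeAct (liftTransf v) U) = integrand χ GF gk A U := by
  filter_upwards [hχ v, hχD] with U hχU hDU hS
  rw [integrand_apply, integrand_apply, hχU hS, hGF v U]
  by_cases hU : U ∈ D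
  · rw [hA v U hU]
  · rw [hDU hS hU, zero_mul, zero_mul]

/-- **THE EFFECTIVE ACTIONS ARE GAUGE INVARIANT ON THE BOOKKEEPING SETS, χ-hypotheses over the fibres of `S (j+1)` only**: for `n ≤ m + K`, coarse sets `S j`, bookkeeping sets `D j`,
`χ_j` lift-invariant and vanishing off `D j` for a.e. `U` WITH `Ū ∈ S (j+1)` (`j < n`), and the per-step property «`ρ_j` lift-invariant a.e. over `Ū⁻¹ S (j+1)` ⇒ `T K j ρ_j` invariant
ON `D (j+1)`», every `A_k`, `k ≤ n`, is invariant on `D k` (`A_0` everywhere) — dag-n09-a's induction with the a.e.-over-`S` density step.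
[cite: Balaban1987RG1, p.263, (0.13) p.254, (0.19) p.255 and (2.1) p.265] -/
theorem invOn_effActionHT_of_stepsOn_on (T : Transport F N) (χ : (K : ℕ) → (ℕ → ℝ) → (k : ℕ) → Density (F.P K) k (SU N)) (K : ℕ) (g : ℕ → ℝ)
    {n : ℕ} (hn : n ≤ (F.P K).m + (F.P K).K) (S : (j : ℕ) → Set (GaugeField (F.P K) j (SU N))) (D : (j : ℕ) → Set (GaugeField (F.P K) j (SU N)))
    (hχ : ∀ j < n, ∀ v : GaugeTransf (F.P K) (j + 1) (SU N), ∀ᵐ U ∂(fieldMeasure (F.P K) j (SU N)),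
      (avOfRecord F N K j).avg U ∈ S (j + 1) → χ K g j (gaugeAct (liftTransf v) U) = χ K g j U)
    (hχD : ∀ j < n, ∀ᵐ U ∂(fieldMeasure (F.P K) j (SU N)), (avOfRecord F N K j).avg U ∈ S (j + 1) → U ∉ D j → χ K g j U = 0)
    (hstep : ∀ j < n, (∀ v : GaugeTransf (F.P K) (j + 1) (SU N), ∀ᵐ U ∂(fieldMeasure (F.P K) j (SU N)), (avOfRecord F N K j).avg U ∈ S (j + 1) →
        integrand (χ K g j) (gfOfRecord F N K j) (g j) (effActionHT F N T χ K g j) (gaugeAct (liftTransf v) U) =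
          integrand (χ K g j) (gfOfRecord F N K j) (g j) (effActionHT F N T χ K g j) U) →
      ∀ (v : GaugeTransf (F.P K) (j + 1) (SU N)) (V : GaugeField (F.P K) (j + 1) (SU N)), V ∈ D (j + 1) →
        T K j (integrand (χ K g j) (gfOfRecord F N K j) (g j) (effActionHT F N T χ K g j)) (gaugeAct v V) =
          T K j (integrand (χ K g j) (gfOfRecord F N K j) (g j) (effActionHT F N T χ K g j)) V) :
    ∀ k ≤ n, ∀ (v : GaugeTransf (F.P K) k (SU N)) (V : GaugeField (F.P K) k (SU N)), V ∈ D k →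
      effActionHT F N T χ K g k (gaugeAct v V) = effActionHT F N T χ K g k V := by
  intro k
  induction k with
  | zero => intro _ v V _; rw [effActionHT_zero]; exact T4WilsonGaugeFlatDirection.gaugeInvariant_wilsonExponent _ _ v V
  | succ k ih =>
    intro hk
    have hk' : k < n := Nat.lt_of_succ_le hk
    refine invOn_effActionHT_succ_of_stepOn T χ K g k (hstep k hk' ?_)
    exact integrand_comp_liftAct_ae_eq_on_of_invOn (hχ k hk') (gfOfRecord_liftInvariant F N K ((Nat.succ_le_of_lt hk').trans hn))
      (hχD k hk') (fun v U hU => ih hk'.le (liftTransf v) U hU) (g k)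

/-- **`HCompT` FROM THE [B11] INPUTS + NESTING + THE PER-STEP PROPERTY, χ-hypotheses over the fibres of `S (j+1)` only** (levels `k ≤ n ≤ K`).
[cite: Balaban1987RG1, (0.21)–(0.23) p.256, (1.1)–(1.2) p.260, p.263 and (2.16) p.269; Balaban1985Variational, Thm 1 (8)–(10) p.279] -/
theorem hCompT_of_stepsOn_on (T : Transport F N) (χ : (K : ℕ) → (ℕ → ℝ) → (k : ℕ) → Density (F.P K) k (SU N)) {ε : ℝ} (K : ℕ) (g : ℕ → ℝ)
    {n : ℕ} (hn : n ≤ K) (S : (j : ℕ) → Set (GaugeField (F.P K) j (SU N))) (D : (j : ℕ) → Set (GaugeField (F.P K) j (SU N)))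
    (hχ : ∀ j < n, ∀ v : GaugeTransf (F.P K) (j + 1) (SU N), ∀ᵐ U ∂(fieldMeasure (F.P K) j (SU N)),
      (avOfRecord F N K j).avg U ∈ S (j + 1) → χ K g j (gaugeAct (liftTransf v) U) = χ K g j U)
    (hχD : ∀ j < n, ∀ᵐ U ∂(fieldMeasure (F.P K) j (SU N)), (avOfRecord F N K j).avg U ∈ S (j + 1) → U ∉ D j → χ K g j U = 0)
    (hstep : ∀ j < n, (∀ v : GaugeTransf (F.P K) (j + 1) (SU N), ∀ᵐ U ∂(fieldMeasure (F.P K) j (SU N)), (avOfRecord F N K j).avg U ∈ S (j + 1) →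
        integrand (χ K g j) (gfOfRecord F N K j) (g j) (effActionHT F N T χ K g j) (gaugeAct (liftTransf v) U) =
          integrand (χ K g j) (gfOfRecord F N K j) (g j) (effActionHT F N T χ K g j) U) →
      ∀ (v : GaugeTransf (F.P K) (j + 1) (SU N)) (V : GaugeField (F.P K) (j + 1) (SU N)), V ∈ D (j + 1) →
        T K j (integrand (χ K g j) (gfOfRecord F N K j) (g j) (effActionHT F N T χ K g j)) (gaugeAct v V) =
          T K j (integrand (χ K g j) (gfOfRecord F N K j) (g j) (effActionHT F N T χ K g j)) V)
    {k : ℕ} (hk : k ≤ n) {dom : Set (GaugeField (F.P K) k (SU N))} (hres : HRestrict F N ε K k dom)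
    (huniq : ∀ V ∈ dom, ∀ j < k, UniqueUkOrbit F N K (j + 1) ε (Averaging.iter (avOfRecord F N K) (j + 1) (Uk F N K k ε V)))
    (hnest : ∀ V ∈ dom, ∀ j < k, Averaging.iter (avOfRecord F N K) j (Uk F N K k ε V) ∈ D j) :
    HCompT F N T χ ε K g k dom :=
  have hn' : n ≤ (F.P K).m + (F.P K).K := hn.trans (Nat.le_add_left _ _)
  hCompT_of_hOrbit_of_invOn T χ K g (hk.trans hn') (hOrbit_of_hRestrict_of_unique F N hres huniq) D
    (fun j hj v W hW => invOn_effActionHT_of_stepsOn_on T χ K g hn' S D hχ hχD hstep j (hj.le.trans hk) v W hW) hnest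

/-- **THE MEMBER OVER A TRANSPORT WITH THE PER-STEP PROPERTY ON THE BOOKKEEPING SETS, χ-hypotheses over the fibres of `S (j+1)` only** (the transport-generic plug
`B12NodeKnitIndAPlug.thm3Member_of_indATPlug_of_hCompT` + `hCompT_of_stepsOn_on`). [cite: Balaban1987RG1, Thm 3 p.264, (1.1)–(1.3) p.260, p.263 and (2.16) p.269; Balaban1985Variational, Thm 1 p.279] -/
theorem thm3Member_of_indATPlug_of_stepsOn_on {w : WorldP} {P : B12.RunParams} (T' : Transport F N)
    (χ : (K : ℕ) → (ℕ → ℝ) → (k : ℕ) → Density (F.P K) k (SU N)) (ε : ℝ) (β : HBeta) (dom : (k : ℕ) → Set (GaugeField (F.P P.K) k (SU N)))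
    (S D : (j : ℕ) → Set (GaugeField (F.P P.K) j (SU N))) (hflow : (w.C P).flow = genFlow β P.g0)
    (hind : ∀ k, k ≤ P.K → ((w.C P).IndAss k ↔
      IndAOfRecordT F N T' χ ε β P k (prefixOf (genSeq β P.g0) k) (dom k) (effActionOfRecordT F N T' χ β P k) (wilsonBGOfRecord F N ε P k)
        (EkOfRecordT F N T' χ ε β P k)))
    (hχ : ∀ k, k ≤ P.K → ∀ n ≤ k, χ P.K (extd (prefixOf (genSeq β P.g0) k)) n = χ P.K (genSeq β P.g0) n)
    (hχinv : ∀ j < P.K, ∀ v : GaugeTransf (F.P P.K) (j + 1) (SU N), ∀ᵐ U ∂(fieldMeasure (F.P P.K) j (SU N)),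
      (avOfRecord F N P.K j).avg U ∈ S (j + 1) → χ P.K (genSeq β P.g0) j (gaugeAct (liftTransf v) U) = χ P.K (genSeq β P.g0) j U)
    (hχD : ∀ j < P.K, ∀ᵐ U ∂(fieldMeasure (F.P P.K) j (SU N)), (avOfRecord F N P.K j).avg U ∈ S (j + 1) → U ∉ D j → χ P.K (genSeq β P.g0) j U = 0)
    (hstep : ∀ j < P.K, (∀ v : GaugeTransf (F.P P.K) (j + 1) (SU N), ∀ᵐ U ∂(fieldMeasure (F.P P.K) j (SU N)), (avOfRecord F N P.K j).avg U ∈ S (j + 1) →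
        integrand (χ P.K (genSeq β P.g0) j) (gfOfRecord F N P.K j) (genSeq β P.g0 j) (effActionHT F N T' χ P.K (genSeq β P.g0) j) (gaugeAct (liftTransf v) U) =
          integrand (χ P.K (genSeq β P.g0) j) (gfOfRecord F N P.K j) (genSeq β P.g0 j) (effActionHT F N T' χ P.K (genSeq β P.g0) j) U) →
      ∀ (v : GaugeTransf (F.P P.K) (j + 1) (SU N)) (V : GaugeField (F.P P.K) (j + 1) (SU N)), V ∈ D (j + 1) →
        T' P.K j (integrand (χ P.K (genSeq β P.g0) j) (gfOfRecord F N P.K j) (genSeq β P.g0 j) (effActionHT F N T' χ P.K (genSeq β P.g0) j)) (gaugeAct v V) =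
          T' P.K j (integrand (χ P.K (genSeq β P.g0) j) (gfOfRecord F N P.K j) (genSeq β P.g0 j) (effActionHT F N T' χ P.K (genSeq β P.g0) j)) V)
    (h11 : ∀ k, k ≤ P.K → ∀ V ∈ dom k, UkExists F N P.K k ε V ∧ UniqueUkOrbit F N P.K k ε V)
    (hres : ∀ k, k ≤ P.K → HRestrict F N ε P.K k (dom k))
    (huniq : ∀ k, k ≤ P.K → ∀ V ∈ dom k, ∀ j < k,
      UniqueUkOrbit F N P.K (j + 1) ε (Averaging.iter (avOfRecord F N P.K) (j + 1) (Uk F N P.K k ε V)))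
    (hnest : ∀ k, k ≤ P.K → ∀ V ∈ dom k, ∀ j < k, Averaging.iter (avOfRecord F N P.K) j (Uk F N P.K k ε V) ∈ D j) :
    (leavesP w P).smallCouplings → (leavesP w P).smallFieldInductive :=
  thm3Member_of_indATPlug_of_hCompT T' χ ε β dom hflow hind hχ h11 fun k hk =>
    hCompT_of_stepsOn_on T' χ P.K (genSeq β P.g0) le_rfl S D hχinv hχD hstep hk (hres k hk) (huniq k hk) (hnest k hk)

end Engine

/-! ## §2. The per-step supplier of the v1.7 token: `TβOfRecord₁₃ = TcanOfRecord` is gauge invariant on `regSetOfRecord K j ρ_j ∩ O` for an OPEN gauge-stable `O` over whose fibres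
`ρ_j` is a.e.-lift-invariant (this seat's `Node00.TcanOfRecord_gaugeAct_of_mem_regSet_inter_of_on`) -/

section Step

variable {F : T4Family} {N : ℕ} [NeZero N]

/-- The record's small-field domain is gauge-STABLE in the `iff` form (dag-n09-a's `domAltOfRecord_gaugeAct_mem` both ways, `(V^v)^{v⁻¹} = V`). [cite: Balaban1987RG1, p.259 and (0.21) p.256] -/
theorem domAltOfRecord_gaugeAct_mem_iff (ν : Stage7Numerics) (K k : ℕ) (v : GaugeTransf (F.P K) k (SU N)) (V : GaugeField (F.P K) k (SU N)) :
    gaugeAct v V ∈ domAltOfRecord F N ν K k ↔ V ∈ domAltOfRecord F N ν K k := by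
  refine ⟨fun h => ?_, domAltOfRecord_gaugeAct_mem ν K k v V⟩
  have h' := domAltOfRecord_gaugeAct_mem ν K k (invTransf v) _ h
  rwa [gaugeAct_inv_gaugeAct] at h'

variable (F N) in
/-- **THE ON-SET PER-STEP PROPERTY OF `TβOfRecord₁₃ = TcanOfRecord` WITH LIFT-INVARIANCE OVER THE FIBRES OF `O` ONLY**: for `j < K`, `ρ` integrable at step `j`, an OPEN gauge-stable set
`O` of coarse fields and a bookkeeping set `D ⊆ regSetOfRecord K j ρ ∩ O`: IF `ρ(U^{ṽ}) = ρ(U)` for `dU`-a.e. `U` with `Ū ∈ O` THEN the canonical-version transform is gauge invariant at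
every point of `D` (`Node00.TcanOfRecord_gaugeAct_of_mem_regSet_inter_of_on`). [cite: Balaban1987RG1, (0.13) p.254, p.259 and p.263] -/
theorem stepOn_TβOfRecord₁₃_of_subset_regSet_inter_of_on {K j : ℕ} (hj : j < K) (ρ : Density (F.P K) j (SU N))
    (hint : Integrable ρ (fieldMeasure (F.P K) j (SU N))) {O : Set (GaugeField (F.P K) (j + 1) (SU N))}
    (hOo : IsOpen (X := PBond (F.P K) (j + 1) → SU N) O)
    (hOst : ∀ (v : GaugeTransf (F.P K) (j + 1) (SU N)) (V : GaugeField (F.P K) (j + 1) (SU N)), gaugeAct v V ∈ O ↔ V ∈ O)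
    {D : Set (GaugeField (F.P K) (j + 1) (SU N))} (hD : D ⊆ regSetOfRecord F N K j ρ ∩ O) :
    (∀ v : GaugeTransf (F.P K) (j + 1) (SU N), ∀ᵐ U ∂(fieldMeasure (F.P K) j (SU N)), (avOfRecord F N K j).avg U ∈ O → ρ (gaugeAct (liftTransf v) U) = ρ U) →
      ∀ (v : GaugeTransf (F.P K) (j + 1) (SU N)) (V : GaugeField (F.P K) (j + 1) (SU N)), V ∈ D →
        TβOfRecord₁₃ F N K j ρ (gaugeAct v V) = TβOfRecord₁₃ F N K j ρ V :=
  fun hlift v _ hV => TcanOfRecord_gaugeAct_of_mem_regSet_inter_of_on hj hint hOo hOst hlift v (hD hV)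

end Step

/-! ## §3. At the Stage-13 v1.7 `SepCoPH` record: `S_{j+1} := domAltOfRecord θ.ν K (j+1)`, `D_{j+1} := regSetOfRecord K j ρ_j ∩ S_{j+1}` -/

section Stage13

variable {F : T4Family} {N : ℕ} [NeZero N]

/-- **THE THEOREM-3 MEMBER AT THE STAGE-13 v1.7 CONSTRUCTION ON THE SMALL-FIELD DOMAINS**: for `w.C = (datumOfRecord₁₃SepCoPH θ h).C` and a run `P`, `smallCouplings → smallFieldInductive`
follows from — (M1-dom) «`χ^{(2.9)}_j(U^{v∘blockOf}) = χ^{(2.9)}_j(U)` for `dU`-a.e. `U` with `Ū ∈ domAltOfRecord θ.ν K (j+1)`» (`j < K`); (F7a-dom) «for `dU`-a.e. `U` with `Ū ∈ domAltOfRecord θ.ν K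
(i+2)`: `U ∉ regSetOfRecord K i ρ_i ∩ domAltOfRecord θ.ν K (i+1) ⇒ χ^{(2.9)}_{i+1}(U) = 0`» (`i + 1 < K`); (I19) integrability of the (0.19) densities met; [B11] Thm 1's three binders
on the record's domains; and the NESTING «`Ū^{i+1}(U_k V) ∈ regSetOfRecord K i ρ_i ∩ domAltOfRecord θ.ν K (i+1)`» for `V ∈ domAlt_k`, `i + 1 < k ≤ K`.  The engine's bookkeeping sets are
`D 0 := univ`, `D (i+1) := regSetOfRecord K i ρ_i ∩ domAltOfRecord θ.ν K (i+1)`; its per-step input is §2 at `O := domAltOfRecord θ.ν K (j+1)` (open, gauge-stable).  NO hypothesis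
mentions a coarse field off the small-field domains.  CONDITIONAL; nothing of Bałaban asserted; N09 NOT discharged.
[cite: Balaban1987RG1, Thm 3 p.264, (1.1)–(1.3) p.260, (0.13) p.254, p.256, p.259, p.263, (2.1) p.265, (2.9)–(2.10) pp.266–267, (2.16) p.269; Balaban1985Variational, Thm 1 (8)–(10) p.279] -/
theorem thm3Member_stage13SepCoPH_onDomains (θ : Stage13HParams F N) (h : θ.Provisos₁₃SepCoPH F N) {w : WorldP}
    (hC : w.C = (datumOfRecord₁₃SepCoPH F N θ h).C) (P : B12.RunParams)
    (hχinv : ∀ j < P.K, ∀ v : GaugeTransf (F.P P.K) (j + 1) (SU N), ∀ᵐ U ∂(fieldMeasure (F.P P.K) j (SU N)),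
      (avOfRecord F N P.K j).avg U ∈ domAltOfRecord F N θ.ν P.K (j + 1) →
        chiβOfRecord₁₃ F N θ.toStage13Params P.K (gOfRecord₁₃ F N θ.toStage13Params P) j (gaugeAct (liftTransf v) U) =
          chiβOfRecord₁₃ F N θ.toStage13Params P.K (gOfRecord₁₃ F N θ.toStage13Params P) j U)
    (hχreg : ∀ i, i + 1 < P.K → ∀ᵐ U ∂(fieldMeasure (F.P P.K) (i + 1) (SU N)),
      (avOfRecord F N P.K (i + 1)).avg U ∈ domAltOfRecord F N θ.ν P.K (i + 2) →
        U ∉ regSetOfRecord F N P.K i (betaInputOfRecord F N (TβOfRecord₁₃ F N) (chiβOfRecord₁₃ F N θ.toStage13Params) P.K (gOfRecord₁₃ F N θ.toStage13Params P) i) ∩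
            domAltOfRecord F N θ.ν P.K (i + 1) →
          chiβOfRecord₁₃ F N θ.toStage13Params P.K (gOfRecord₁₃ F N θ.toStage13Params P) (i + 1) U = 0)
    (hint : ∀ j < P.K, Integrable (betaInputOfRecord F N (TβOfRecord₁₃ F N) (chiβOfRecord₁₃ F N θ.toStage13Params) P.K (gOfRecord₁₃ F N θ.toStage13Params P) j)
      (fieldMeasure (F.P P.K) j (SU N)))
    (h11 : ∀ k, k ≤ P.K → ∀ V ∈ domAltOfRecord F N θ.ν P.K k, UkExists F N P.K k θ.εbg V ∧ UniqueUkOrbit F N P.K k θ.εbg V)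
    (hres : ∀ k, k ≤ P.K → HRestrict F N θ.εbg P.K k (domAltOfRecord F N θ.ν P.K k))
    (huniq : ∀ k, k ≤ P.K → ∀ V ∈ domAltOfRecord F N θ.ν P.K k, ∀ j < k,
      UniqueUkOrbit F N P.K (j + 1) θ.εbg (Averaging.iter (avOfRecord F N P.K) (j + 1) (Uk F N P.K k θ.εbg V)))
    (hnestreg : ∀ k, k ≤ P.K → ∀ V ∈ domAltOfRecord F N θ.ν P.K k, ∀ i, i + 1 < k →
      Averaging.iter (avOfRecord F N P.K) (i + 1) (Uk F N P.K k θ.εbg V) ∈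
        regSetOfRecord F N P.K i (betaInputOfRecord F N (TβOfRecord₁₃ F N) (chiβOfRecord₁₃ F N θ.toStage13Params) P.K (gOfRecord₁₃ F N θ.toStage13Params P) i) ∩
          domAltOfRecord F N θ.ν P.K (i + 1)) :
    (leavesP w P).smallCouplings → (leavesP w P).smallFieldInductive := by
  refine thm3Member_of_indATPlug_of_stepsOn_on (TβOfRecord₁₃ F N) (chiβOfRecord₁₃ F N θ.toStage13Params) θ.εbg (betaOfRecord₁₃ F N θ.toStage13Params)
    (fun k => domAltOfRecord F N θ.ν P.K k) (fun j => domAltOfRecord F N θ.ν P.K j)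
    (fun j => Nat.rec (motive := fun j => Set (GaugeField (F.P P.K) j (SU N))) Set.univ
      (fun i _ => regSetOfRecord F N P.K i
        (betaInputOfRecord F N (TβOfRecord₁₃ F N) (chiβOfRecord₁₃ F N θ.toStage13Params) P.K (gOfRecord₁₃ F N θ.toStage13Params P) i) ∩
          domAltOfRecord F N θ.ν P.K (i + 1)) j)
    (by rw [hC]; exact flow_stage13SepCoPH F N θ h P) (fun k _ => by rw [hC]; exact indAss_stage13SepCoPH_iff F N θ h P k)
    (fun _ _ _ _ => rfl) hχinv ?_ ?_ h11 hres huniq ?_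
  · intro j hj
    cases j with
    | zero => exact Filter.Eventually.of_forall fun U _ hU => absurd (Set.mem_univ U) hU
    | succ i => exact hχreg i hj
  · intro j hj hlift
    exact stepOn_TβOfRecord₁₃_of_subset_regSet_inter_of_on F N hj _ (hint j hj) (isOpen_domAltOfRecord θ.ν P.K (j + 1))
      (fun v V => domAltOfRecord_gaugeAct_mem_iff θ.ν P.K (j + 1) v V) subset_rfl hlift
  · intro k hk V hV j hjk
    cases j with
    | zero => exact Set.mem_univ _
    | succ i => exact hnestreg k hk V hV i hjk

/-- **THE `∀ P` FORM = N24's DISPLAYED BINDER `h09T` AT A WORLD BOUND TO THE STAGE-13 v1.7 CONSTRUCTION, ON THE SMALL-FIELD DOMAINS** (run by run from (M1-dom), (F7a-dom), (I19),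
[B11] ×3 and the nesting).  CONDITIONAL; N09 NOT discharged; K1⁷ NOT closed. [cite: Balaban1987RG1, Thm 3 p.264, (1.1)–(1.3) p.260, (2.1) p.265, (2.9)–(2.10) pp.266–267; Balaban1985Variational, Thm 1 (8)–(10) p.279] -/
theorem thm3Member_forall_stage13SepCoPH_onDomains (θ : Stage13HParams F N) (h : θ.Provisos₁₃SepCoPH F N) {w : WorldP}
    (hC : w.C = (datumOfRecord₁₃SepCoPH F N θ h).C)
    (hχinv : ∀ (P : B12.RunParams), ∀ j < P.K, ∀ v : GaugeTransf (F.P P.K) (j + 1) (SU N), ∀ᵐ U ∂(fieldMeasure (F.P P.K) j (SU N)),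
      (avOfRecord F N P.K j).avg U ∈ domAltOfRecord F N θ.ν P.K (j + 1) →
        chiβOfRecord₁₃ F N θ.toStage13Params P.K (gOfRecord₁₃ F N θ.toStage13Params P) j (gaugeAct (liftTransf v) U) =
          chiβOfRecord₁₃ F N θ.toStage13Params P.K (gOfRecord₁₃ F N θ.toStage13Params P) j U)
    (hχreg : ∀ (P : B12.RunParams) (i : ℕ), i + 1 < P.K → ∀ᵐ U ∂(fieldMeasure (F.P P.K) (i + 1) (SU N)),
      (avOfRecord F N P.K (i + 1)).avg U ∈ domAltOfRecord F N θ.ν P.K (i + 2) →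
        U ∉ regSetOfRecord F N P.K i (betaInputOfRecord F N (TβOfRecord₁₃ F N) (chiβOfRecord₁₃ F N θ.toStage13Params) P.K (gOfRecord₁₃ F N θ.toStage13Params P) i) ∩
            domAltOfRecord F N θ.ν P.K (i + 1) →
          chiβOfRecord₁₃ F N θ.toStage13Params P.K (gOfRecord₁₃ F N θ.toStage13Params P) (i + 1) U = 0)
    (hint : ∀ (P : B12.RunParams), ∀ j < P.K, Integrable (betaInputOfRecord F N (TβOfRecord₁₃ F N) (chiβOfRecord₁₃ F N θ.toStage13Params) P.K
      (gOfRecord₁₃ F N θ.toStage13Params P) j) (fieldMeasure (F.P P.K) j (SU N)))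
    (h11 : ∀ (P : B12.RunParams) (k : ℕ), k ≤ P.K → ∀ V ∈ domAltOfRecord F N θ.ν P.K k, UkExists F N P.K k θ.εbg V ∧ UniqueUkOrbit F N P.K k θ.εbg V)
    (hres : ∀ (P : B12.RunParams) (k : ℕ), k ≤ P.K → HRestrict F N θ.εbg P.K k (domAltOfRecord F N θ.ν P.K k))
    (huniq : ∀ (P : B12.RunParams) (k : ℕ), k ≤ P.K → ∀ V ∈ domAltOfRecord F N θ.ν P.K k, ∀ j < k,
      UniqueUkOrbit F N P.K (j + 1) θ.εbg (Averaging.iter (avOfRecord F N P.K) (j + 1) (Uk F N P.K k θ.εbg V)))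
    (hnestreg : ∀ (P : B12.RunParams) (k : ℕ), k ≤ P.K → ∀ V ∈ domAltOfRecord F N θ.ν P.K k, ∀ i, i + 1 < k →
      Averaging.iter (avOfRecord F N P.K) (i + 1) (Uk F N P.K k θ.εbg V) ∈
        regSetOfRecord F N P.K i (betaInputOfRecord F N (TβOfRecord₁₃ F N) (chiβOfRecord₁₃ F N θ.toStage13Params) P.K (gOfRecord₁₃ F N θ.toStage13Params P) i) ∩
          domAltOfRecord F N θ.ν P.K (i + 1)) :
    ∀ P : B12.RunParams, (leavesP w P).smallCouplings → (leavesP w P).smallFieldInductive :=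
  fun P => thm3Member_stage13SepCoPH_onDomains θ h hC P (hχinv P) (hχreg P) (hint P) (h11 P) (hres P) (huniq P) (hnestreg P)

/-- **THE `∀ P` FORM ON THE SMALL-FIELD DOMAINS, (I19) REPLACED BY (H-U)** (measurability of the minimiser selection; dag-n24-c `integrable_betaInput_stage13_of_measurableUk`).
CONDITIONAL; N09 NOT discharged; K1⁷ NOT closed. [cite: Balaban1987RG1, Thm 3 p.264, (0.19) p.255, (1.1)–(1.3) p.260, (2.1) p.265, (2.9)–(2.10) pp.266–267; Balaban1985Variational, Thm 1 (8)–(10) p.279] -/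
theorem thm3Member_forall_stage13SepCoPH_onDomains_of_measurableUk (θ : Stage13HParams F N) (h : θ.Provisos₁₃SepCoPH F N) {w : WorldP}
    (hC : w.C = (datumOfRecord₁₃SepCoPH F N θ h).C)
    (hχinv : ∀ (P : B12.RunParams), ∀ j < P.K, ∀ v : GaugeTransf (F.P P.K) (j + 1) (SU N), ∀ᵐ U ∂(fieldMeasure (F.P P.K) j (SU N)),
      (avOfRecord F N P.K j).avg U ∈ domAltOfRecord F N θ.ν P.K (j + 1) →
        chiβOfRecord₁₃ F N θ.toStage13Params P.K (gOfRecord₁₃ F N θ.toStage13Params P) j (gaugeAct (liftTransf v) U) =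
          chiβOfRecord₁₃ F N θ.toStage13Params P.K (gOfRecord₁₃ F N θ.toStage13Params P) j U)
    (hU : ∀ (P : B12.RunParams) (k : ℕ), k < P.K → Measurable (Uk F N P.K (k + 1) θ.ν.εreg))
    (hχreg : ∀ (P : B12.RunParams) (i : ℕ), i + 1 < P.K → ∀ᵐ U ∂(fieldMeasure (F.P P.K) (i + 1) (SU N)),
      (avOfRecord F N P.K (i + 1)).avg U ∈ domAltOfRecord F N θ.ν P.K (i + 2) →
        U ∉ regSetOfRecord F N P.K i (betaInputOfRecord F N (TβOfRecord₁₃ F N) (chiβOfRecord₁₃ F N θ.toStage13Params) P.K (gOfRecord₁₃ F N θ.toStage13Params P) i) ∩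
            domAltOfRecord F N θ.ν P.K (i + 1) →
          chiβOfRecord₁₃ F N θ.toStage13Params P.K (gOfRecord₁₃ F N θ.toStage13Params P) (i + 1) U = 0)
    (h11 : ∀ (P : B12.RunParams) (k : ℕ), k ≤ P.K → ∀ V ∈ domAltOfRecord F N θ.ν P.K k, UkExists F N P.K k θ.εbg V ∧ UniqueUkOrbit F N P.K k θ.εbg V)
    (hres : ∀ (P : B12.RunParams) (k : ℕ), k ≤ P.K → HRestrict F N θ.εbg P.K k (domAltOfRecord F N θ.ν P.K k))
    (huniq : ∀ (P : B12.RunParams) (k : ℕ), k ≤ P.K → ∀ V ∈ domAltOfRecord F N θ.ν P.K k, ∀ j < k,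
      UniqueUkOrbit F N P.K (j + 1) θ.εbg (Averaging.iter (avOfRecord F N P.K) (j + 1) (Uk F N P.K k θ.εbg V)))
    (hnestreg : ∀ (P : B12.RunParams) (k : ℕ), k ≤ P.K → ∀ V ∈ domAltOfRecord F N θ.ν P.K k, ∀ i, i + 1 < k →
      Averaging.iter (avOfRecord F N P.K) (i + 1) (Uk F N P.K k θ.εbg V) ∈
        regSetOfRecord F N P.K i (betaInputOfRecord F N (TβOfRecord₁₃ F N) (chiβOfRecord₁₃ F N θ.toStage13Params) P.K (gOfRecord₁₃ F N θ.toStage13Params P) i) ∩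
          domAltOfRecord F N θ.ν P.K (i + 1)) :
    ∀ P : B12.RunParams, (leavesP w P).smallCouplings → (leavesP w P).smallFieldInductive :=
  fun P => thm3Member_stage13SepCoPH_onDomains θ h hC P (hχinv P) (hχreg P)
    (integrable_betaInput_stage13_of_measurableUk θ.toStage13Params P (hU P)) (h11 P) (hres P) (huniq P) (hnestreg P)

end Stage13


/-! ## §4. (M1-dom) FROM [B11] (181)-COVARIANCE OF THE SELECTION ON THE SOLVABLE SET (dag-n09-w2's `chiFix29OfRecord_gaugeAct_liftTransf_of_covariantOn`, item 2) and [B11] Thm 1's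
existence clause on the small-field domain at the cut-off's radius `ν.εreg` — and the member with the selection clause located at [B11] (181) -/

section Covariant

variable {F : T4Family} {N : ℕ} [NeZero N]

/-- **(M1-dom) FROM COVARIANCE ON THE SOLVABLE SET**: if the critical configuration (2.3) is block-lift covariant at every SOLVABLE coarse field ([B11] (181) for the minimiser
selection — dag-n09-w2's located clause, NOT derivable for the bare choice, NOT asserted) and every field of the small-field domain of level `j+1` is solvable at the cut-off's
radius `ν.εreg` ([B11] Thm 1 existence), then `χ^{(2.9)}_j(U^{v∘blockOf}) = χ^{(2.9)}_j(U)` at EVERY (hence a.e.) `U` with `Ū ∈ domAltOfRecord ν K (j+1)` — the junk corner is never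
visited. [cite: Balaban1987RG1, (2.3) p.265 and (2.9) p.266; Balaban1985Variational, (181) p.307 and Thm 1 p.279] -/
theorem chiβ13_gaugeAct_liftTransf_ae_on_of_covariantOn (θ₀ : Stage13Params F N) (P : B12.RunParams)
    (hcov : ∀ j < P.K, ∀ (v : GaugeTransf (F.P P.K) (j + 1) (SU N)) (W : GaugeField (F.P P.K) (j + 1) (SU N)), UkExists F N P.K (j + 1) θ₀.ν.εreg W →
      critCfgOfRecord F N θ₀.ν P.K j (gaugeAct v W) = gaugeAct (liftTransf v) (critCfgOfRecord F N θ₀.ν P.K j W))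
    (hsolv : ∀ j < P.K, ∀ W ∈ domAltOfRecord F N θ₀.ν P.K (j + 1), UkExists F N P.K (j + 1) θ₀.ν.εreg W) :
    ∀ j < P.K, ∀ v : GaugeTransf (F.P P.K) (j + 1) (SU N), ∀ᵐ U ∂(fieldMeasure (F.P P.K) j (SU N)),
      (avOfRecord F N P.K j).avg U ∈ domAltOfRecord F N θ₀.ν P.K (j + 1) →
        chiβOfRecord₁₃ F N θ₀ P.K (gOfRecord₁₃ F N θ₀ P) j (gaugeAct (liftTransf v) U) = chiβOfRecord₁₃ F N θ₀ P.K (gOfRecord₁₃ F N θ₀ P) j U := by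
  intro j hj v
  have hk : j + 1 ≤ (F.P P.K).m + (F.P P.K).K := by simp only [T4Continuum.T4Family.P_K]; omega
  exact Filter.Eventually.of_forall fun U hU =>
    N09LiftInvariance29AtRecord.chiFix29OfRecord_gaugeAct_liftTransf_of_covariantOn θ₀.ε₂₉ hk (hcov j hj) v U (hsolv j hj _ hU)

/-- **THE `∀ P` FORM ON THE SMALL-FIELD DOMAINS WITH THE SELECTION CLAUSE LOCATED AT [B11] (181)**: N24's `h09T` at a world bound to the Stage-13 v1.7 construction from —
(181)-COVARIANCE of the critical configuration on the solvable set (`hcov`, dag-n09-w2's clause); [B11] Thm 1 existence on the small-field domains at radius `ν.εreg` (`hsolv`);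
(F7a-dom); (I19); [B11] Thm 1's three binders at radius `εbg` (`h11 ∕ hres ∕ huniq`, N07); the nesting in `regSet ∩ domAlt`.  NO χ-invariance hypothesis and NO hypothesis about a
coarse field off the small-field domains.  CONDITIONAL; nothing of Bałaban asserted; N09 NOT discharged; K1⁷ NOT closed.
[cite: Balaban1987RG1, Thm 3 p.264, (1.1)–(1.3) p.260, (2.1)–(2.3) p.265, (2.9)–(2.10) pp.266–267; Balaban1985Variational, Thm 1 (8)–(10) p.279 and (181) p.307] -/
theorem thm3Member_forall_stage13SepCoPH_onDomains_of_covariantOn (θ : Stage13HParams F N) (h : θ.Provisos₁₃SepCoPH F N) {w : WorldP}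
    (hC : w.C = (datumOfRecord₁₃SepCoPH F N θ h).C)
    (hcov : ∀ (P : B12.RunParams), ∀ j < P.K, ∀ (v : GaugeTransf (F.P P.K) (j + 1) (SU N)) (W : GaugeField (F.P P.K) (j + 1) (SU N)),
      UkExists F N P.K (j + 1) θ.ν.εreg W →
        critCfgOfRecord F N θ.ν P.K j (gaugeAct v W) = gaugeAct (liftTransf v) (critCfgOfRecord F N θ.ν P.K j W))
    (hsolv : ∀ (P : B12.RunParams), ∀ j < P.K, ∀ W ∈ domAltOfRecord F N θ.ν P.K (j + 1), UkExists F N P.K (j + 1) θ.ν.εreg W)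
    (hχreg : ∀ (P : B12.RunParams) (i : ℕ), i + 1 < P.K → ∀ᵐ U ∂(fieldMeasure (F.P P.K) (i + 1) (SU N)),
      (avOfRecord F N P.K (i + 1)).avg U ∈ domAltOfRecord F N θ.ν P.K (i + 2) →
        U ∉ regSetOfRecord F N P.K i (betaInputOfRecord F N (TβOfRecord₁₃ F N) (chiβOfRecord₁₃ F N θ.toStage13Params) P.K (gOfRecord₁₃ F N θ.toStage13Params P) i) ∩
            domAltOfRecord F N θ.ν P.K (i + 1) →
          chiβOfRecord₁₃ F N θ.toStage13Params P.K (gOfRecord₁₃ F N θ.toStage13Params P) (i + 1) U = 0)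
    (hint : ∀ (P : B12.RunParams), ∀ j < P.K, Integrable (betaInputOfRecord F N (TβOfRecord₁₃ F N) (chiβOfRecord₁₃ F N θ.toStage13Params) P.K
      (gOfRecord₁₃ F N θ.toStage13Params P) j) (fieldMeasure (F.P P.K) j (SU N)))
    (h11 : ∀ (P : B12.RunParams) (k : ℕ), k ≤ P.K → ∀ V ∈ domAltOfRecord F N θ.ν P.K k, UkExists F N P.K k θ.εbg V ∧ UniqueUkOrbit F N P.K k θ.εbg V)
    (hres : ∀ (P : B12.RunParams) (k : ℕ), k ≤ P.K → HRestrict F N θ.εbg P.K k (domAltOfRecord F N θ.ν P.K k))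
    (huniq : ∀ (P : B12.RunParams) (k : ℕ), k ≤ P.K → ∀ V ∈ domAltOfRecord F N θ.ν P.K k, ∀ j < k,
      UniqueUkOrbit F N P.K (j + 1) θ.εbg (Averaging.iter (avOfRecord F N P.K) (j + 1) (Uk F N P.K k θ.εbg V)))
    (hnestreg : ∀ (P : B12.RunParams) (k : ℕ), k ≤ P.K → ∀ V ∈ domAltOfRecord F N θ.ν P.K k, ∀ i, i + 1 < k →
      Averaging.iter (avOfRecord F N P.K) (i + 1) (Uk F N P.K k θ.εbg V) ∈
        regSetOfRecord F N P.K i (betaInputOfRecord F N (TβOfRecord₁₃ F N) (chiβOfRecord₁₃ F N θ.toStage13Params) P.K (gOfRecord₁₃ F N θ.toStage13Params P) i) ∩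
          domAltOfRecord F N θ.ν P.K (i + 1)) :
    ∀ P : B12.RunParams, (leavesP w P).smallCouplings → (leavesP w P).smallFieldInductive :=
  fun P => thm3Member_stage13SepCoPH_onDomains θ h hC P (chiβ13_gaugeAct_liftTransf_ae_on_of_covariantOn θ.toStage13Params P (hcov P) (hsolv P))
    (hχreg P) (hint P) (h11 P) (hres P) (huniq P) (hnestreg P)

end Covariant

end Summit.QuantumFields.YangMills.BalabanUVNodes.N09AtRecord13SepCoPHOnDomains

end
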